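import Summits.QuantumFields.YangMills.Theorems.UnitScaleTiltProp7RLegsLinTowerRowsLettersT3
import Summits.QuantumFields.YangMills.Theorems.UnitScaleTiltProp7CornerCombLinTowerCellRows
import Summits.QuantumFields.YangMills.Theorems.UnitScaleTiltProp7CornerCombLinTowerGaugeRowClosed
import Summits.QuantumFields.YangMills.Theorems.UnitScaleTiltProp7CornerCombGaugeRowWeights
import Summits.QuantumFields.YangMills.Theorems.UnitScaleTiltProp7CombLevelMassSlotLetters
import Summits.QuantumFields.YangMills.Theorems.UnitScaleTiltProp7CornerCombCellTheorem
import Summits.QuantumFields.YangMills.Theorems.UnitScaleTiltProp7LandauCombDict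
import Summits.QuantumFields.YangMills.Theorems.UnitScaleTiltProp7CombTildRem2HMcomb2MemberRowsT3
import Summits.QuantumFields.YangMills.Theorems.UnitScaleTiltProp7RLegsLinTowerSlots
import HarnessLib

/-!
# Route `UnitScaleTilt`, crux K1 «MinimiserStabilityRegPr» (stmt-QuantumFields-19200), LANE II (R-LEGS) — file F-9d-c «THE LINEAR-RESPONSE TOWER'S TWO ROWS AT THE MEMBER»:
# the displayed hypotheses (hG) GRADIENT ENERGY and (hN′) MASS of ✓p718441 `Prop7RLegsCovKnit.covGradLegs_of_linTower_rows` INHABITED at every printed-regular member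

Cell `ym3-torus`, width seat `ym3-torus-px18` (gen 5); pen F-9d ≡ F-8′ (★routeR-w1 g10; ★routeR-w2 g10's DESIGN POINT «instantiate the cell theorem at tower height `k := l`»;
w4-20520 SPEC #58∕#59).  THEOREMS ONLY (0 `def`, 0 `sorry`); `--supports stmt-QuantumFields-19200 --as helper`, count-neutral.  YM₃ on T³ is a ladder rung (R3), not the Clay
problem; nothing here claims `rlegs`, (QB), `hEng`, `hMcomb`, (β), the stub, the crux, d = 4 or the mass gap.

THE POINT.  `Y_l = D[Ũˡ(W♯,(eᵗᴬ)♯)]·A = Q l (A♯)` is the SOURCELESS linearised comb tower of the datum `A♯` (✓`fderiv_coe_tildIter_eq_linTower_pull_of_regPr`, re-indexed on the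
period cell by ★routeR-w2's ✓p720605 letters).  ✓F-9d-a `sum_cell_linTower_rows` at TOWER HEIGHT `k := l` (top cell `(F.P K).sitesPerDir l`, windows read off `RegPr` by ✓F-8c-3a
with the SCALED plaquette cap `aC := 4e·ρ^{4(K−n−l)}`, so `θ_g ∝ e·ρ^{4(K−n−l)}`, `ΘM ∝ e²·ρ^{8(K−n−l)}`), its gauge row by ✓F-9d-b `gauge_row_sourceless` (★routeR-w6's 5b-0 fold,
★routeR-w4's ✓p720300 weights), and the level-0 currencies `m₀² = SA`, `g₀² = GA` give, after the anchor arithmetic `ρ^{8(K−n−l)}·ρ^{4l}·Lˡ = L^{3l}·ℓ⁻⁴` (✓F-9d-c0 `Prop7RLegsLinTowerSlots`), ★★★ `linTower_rows_master`: for every `L > 1`, L-only constants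
`CN CN′ CW CG` and a radius `eR = (4·10⁷L³)⁻¹` such that at every printed-regular member, every `A`, level `l < K − n`: (hN′) `Σ_{x,κ}‖Y_l x̂ κ‖² ≤ CN·(Lˡ)⁻¹·SA + CN′·Lˡ·GA
+ CW·e²·L^{3l}·ℓ⁻⁴·SA` AND, for every coarse direction `μ`, (hG) `Σ_{x,κ}‖Y_l x̂ κ − Ad_{Ūˡ(x̂,μ)}Y_l(x̂+e_μ) κ‖² ≤ CG·Lˡ·GA + CW·e²·L^{3l}·ℓ⁻⁴·SA` — the left sides and slots of
✓p718441's two hypothesis texts (c2 shape); the VERBATIM projections (and the `ℓ⁻²`-anchored ♭ shapes of ✓p721143) are file F-9d-d `Prop7RLegsLinTowerRowsT3`.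
HONEST SCOPE.  Assembly of landed rows, every estimate by name.  [Balaban1985Variational] (2), (106)–(111) p.294; [Balaban1987RG1] (0.1)∕(0.4) pp.251–253; [Balaban1985Averaging] Prop. 3.
-/

set_option autoImplicit false

noncomputable section

open scoped BigOperators Matrix.Norms.L2Operator
open Finset

namespace Summit.QuantumFields.YangMills.Theorems.Prop7RLegsLinTowerRowsOfRegPr

open Literature.MathematicalPhysics.QuantumFieldTheory.Balaban1983to89
open Literature.MathematicalPhysics.QuantumFieldTheory.Balaban1983to89.T3ContinuumYM3Torus
open T3PrintedRegularMinimiser (RegPr)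
open T3SectALandauChart (bgUnits)
open B7Prop1Explicit renaming Site → LSite
open B7Prop1Explicit (e hol seg boxVec plaqWord Wcx expUnit)
open B7Prop2Explicit (avgIter unitaryUnits)
open B7Eq92Concrete (tildIter)
open B7Eq78Linearization (conjR)
open B7Prop3GeneralLinear (FhatCov)
open T4TermwiseTorus (IsPeriodic)
open B10Eq27TorusAxialLog (pull)
open Summit.QuantumFields.YangMills.Theorems.Prop7SPrint (basePt)
open Summit.QuantumFields.YangMills.Theorems.Prop7CombPeriodCellDict (sitesPerDir_T3 sitesPerDir_T3_mul_pow)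
open Summit.QuantumFields.YangMills.Theorems.Prop7LandauCombDict (isPeriodic_pull)
open Summit.QuantumFields.YangMills.Theorems.Prop7CombTowerWindowsOfRegPr (avgIter_pull_mem_unitaryUnits_of_regPr alpha_level_le_window
  norm_Wcx_avgIter_pull_sub_one_le_level_of_regPr norm_hol_plaqWord_avgIter_pull_sub_one_le_of_regPr norm_avgIter_succ_pull_sub_hol_seg_le_of_regPr)
open Summit.QuantumFields.YangMills.Theorems.Prop7CornerCombStructure (exists_linTower_family)
open Summit.QuantumFields.YangMills.Theorems.Prop7CornerCombFamiliesPeriodic (exists_sourced_reduced_family exists_gauge_family)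
open Summit.QuantumFields.YangMills.Theorems.Prop7CornerCombCellTheorem (rho_slots_T3 rho_letters_T3 rho_pos_lt_one_T3)
open Summit.QuantumFields.YangMills.Theorems.Prop7CombLevelMassSlotLetters (level_ratio_sq_eq_rho_pow kappa_geo_of_windows K_geo_of_windows)
open Summit.QuantumFields.YangMills.Theorems.Prop7CornerCombGaugeRowKernel (cL_nonneg)
open Summit.QuantumFields.YangMills.Theorems.Prop7CornerCombGaugeRowWeights (wG_choice_nonneg wM_choice_nonneg wM_choice_geo numerals_nC_AC)
open Summit.QuantumFields.YangMills.Theorems.Prop7RLegsLinTowerRowsLetters (sum_site_normSq_linResponse_eq_cell sum_site_normSq_covGrad_linResponse_eq_cell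
  cell_mass_eq_SA cell_covGrad_eq_GA)
open Summit.QuantumFields.YangMills.Theorems.Prop7CornerCombLinTowerCellRows (sum_cell_linTower_rows sum_cell_covGrad_dir_le_of_sum)
open Summit.QuantumFields.YangMills.Theorems.Prop7CornerCombLinTowerGaugeRowClosed (gauge_row_sourceless)
open Summit.QuantumFields.YangMills.Theorems.Prop7RLegsLinTowerSlots (mass_three_slots grad_two_slots anchor_arith_T3)

/-! ## ★★★ The two rows at the member (master form) -/

-- hb: the member instantiation walks ✓F-8c-3a's windows, ✓F-9d-a/b and ✓p720605's letters (README HEARTBEAT BUDGET rule: decl-local, never file-global)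
set_option maxHeartbeats 800000 in
/-- ★★★ **THE LINEAR-RESPONSE TOWER'S MASS AND GRADIENT ROWS AT THE MEMBER (master form).**  For every `L > 1` there are L-only constants such that at every
printed-regular member (`RegPr F n K e W`, `e ≤ eR`), for every `A`, level `l < K − n`: the MASS row (hN′) and, for every coarse direction `μ`, the GRADIENT row (hG) of
`Y_l = D[Ũˡ(W♯,(eᵗᴬ)♯)]·A` in ⧗p718441's letters. [cite: Balaban1985Variational, (2), (106)-(111) p.294; Balaban1987RG1, (0.1), (0.4) pp.251-253; Balaban1985Averaging, (42)-(47), Prop. 3 (122)-(126)] -/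
theorem linTower_rows_master : ∀ (L : ℕ), 1 < L → ∃ CN CN' CW CG eR : ℝ, 0 ≤ CN ∧ 0 ≤ CN' ∧ 0 ≤ CW ∧ 0 ≤ CG ∧ 0 < eR ∧
      ∀ (F : T3Family), F.L = L → ∀ (n K : ℕ) (hnK : n < K) (e : ℝ) (W : GaugeField (F.P K) 0 (Matrix.specialUnitaryGroup (Fin 2) ℂ)),
        0 < e → e ≤ eR → RegPr F n K e W → ∀ (A : PBond (F.P K) 0 → Matrix (Fin 2) (Fin 2) ℂ) (l : ℕ), l < K - n →
        (∑ x : Site (F.P K) l, ∑ κ : Fin (F.P K).d,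
          ‖fderiv ℂ (fun t : PBond (F.P K) 0 → Matrix (Fin 2) (Fin 2) ℂ =>
                ((tildIter (F.P K).L (pull (bgUnits F K W) (basePt F n K)) (pull (fun b => expUnit (t b)) (basePt F n K)) l (fun ν => ((x ν).val : ℤ)) κ :
                  (Matrix (Fin 2) (Fin 2) ℂ)ˣ) : Matrix (Fin 2) (Fin 2) ℂ)) 0 A‖ ^ 2
          ≤ CN * ((F.L : ℝ) ^ l)⁻¹ * ∑ b : PBond (F.P K) 0, ‖A b‖ ^ 2
            + CN' * (F.L : ℝ) ^ l * (∑ b : PBond (F.P K) 0, ∑ ν : Fin (F.P K).d,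
                ‖((W ⟨b.src, ν⟩ : Matrix.specialUnitaryGroup (Fin 2) ℂ) : Matrix (Fin 2) (Fin 2) ℂ) * A ⟨b.src.shift ν, b.dir⟩
                    * star ((W ⟨b.src, ν⟩ : Matrix.specialUnitaryGroup (Fin 2) ℂ) : Matrix (Fin 2) (Fin 2) ℂ) - A b‖ ^ 2)
            + CW * e ^ 2 * (F.L : ℝ) ^ (3 * l) * (((F.L : ℝ) ^ (K - n)) ^ 4)⁻¹ * ∑ b : PBond (F.P K) 0, ‖A b‖ ^ 2)
        ∧ (∀ μ : Fin (F.P K).d, ∑ x : Site (F.P K) l, ∑ κ : Fin (F.P K).d,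
          ‖fderiv ℂ (fun t : PBond (F.P K) 0 → Matrix (Fin 2) (Fin 2) ℂ =>
                ((tildIter (F.P K).L (pull (bgUnits F K W) (basePt F n K)) (pull (fun b => expUnit (t b)) (basePt F n K)) l (fun ν => ((x ν).val : ℤ)) κ :
                  (Matrix (Fin 2) (Fin 2) ℂ)ˣ) : Matrix (Fin 2) (Fin 2) ℂ)) 0 A
            - conjR (avgIter (F.P K).L (pull (bgUnits F K W) (basePt F n K)) l (fun ν => ((x ν).val : ℤ)) μ)
              (fderiv ℂ (fun t : PBond (F.P K) 0 → Matrix (Fin 2) (Fin 2) ℂ =>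
                ((tildIter (F.P K).L (pull (bgUnits F K W) (basePt F n K)) (pull (fun b => expUnit (t b)) (basePt F n K)) l ((fun ν => ((x ν).val : ℤ)) + B7Prop1Explicit.e μ) κ :
                  (Matrix (Fin 2) (Fin 2) ℂ)ˣ) : Matrix (Fin 2) (Fin 2) ℂ)) 0 A)‖ ^ 2
          ≤ CG * (F.L : ℝ) ^ l * (∑ b : PBond (F.P K) 0, ∑ ν : Fin (F.P K).d,
                ‖((W ⟨b.src, ν⟩ : Matrix.specialUnitaryGroup (Fin 2) ℂ) : Matrix (Fin 2) (Fin 2) ℂ) * A ⟨b.src.shift ν, b.dir⟩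
                    * star ((W ⟨b.src, ν⟩ : Matrix.specialUnitaryGroup (Fin 2) ℂ) : Matrix (Fin 2) (Fin 2) ℂ) - A b‖ ^ 2)
            + CW * e ^ 2 * (F.L : ℝ) ^ (3 * l) * (((F.L : ℝ) ^ (K - n)) ^ 4)⁻¹ * ∑ b : PBond (F.P K) 0, ‖A b‖ ^ 2) := by
  intro L hL
  have hL1r : (1 : ℝ) < (L : ℝ) := by exact_mod_cast hL
  have hL0r : (0 : ℝ) < (L : ℝ) := by linarith
  have hL2 : 2 ≤ L := hL
  obtain ⟨hρ0, hρ1⟩ := rho_pos_lt_one_T3 hL1r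
  have hcL := cL_nonneg hL1r
  -- ===== the L-only letters (d = 3, matrix size 2, cube letters nC := L²+L−1, AC := 2) =====
  obtain ⟨wG, hwGdef⟩ : ∃ w : ℝ, w = 2 * (3 * ((Real.sqrt L)⁻¹ * (((3 : ℕ) : ℝ) * ((L : ℝ) ^ 2 / 4) * (2 * ((L : ℝ) ^ (3 : ℕ))⁻¹ * (L : ℝ) * (L : ℝ)))
      + (L : ℝ)⁻¹ * (2 * ((3 : ℕ) : ℝ) * (1 - (Real.sqrt L)⁻¹)⁻¹ * ((L : ℝ) ^ 2 / 4) * 2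
        * (((L : ℝ) ^ (3 : ℕ))⁻¹ * (3 * ((2 : ℕ) : ℝ) * (((L * L + L - 1 : ℕ) : ℝ) + 1) ^ 2 * (((3 : ℕ) : ℝ) * (((3 : ℕ) : ℝ) * ((2 : ℕ) : ℝ) ^ (3 : ℕ))))))
      + (Real.sqrt L)⁻¹ * (2 * (1 - (Real.sqrt L)⁻¹)⁻¹ * 2 * (((2 : ℕ) : ℝ) / 2 * ((3 : ℕ) : ℝ) ^ 2 * ((L : ℝ) - 1) ^ 2 * (L : ℝ) ^ 2 * ((3 : ℕ) : ℝ))))) := ⟨_, rfl⟩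
  have hwG : 0 ≤ wG := by rw [hwGdef]; exact wG_choice_nonneg L 3 2 (L * L + L - 1) 2 hL2
  -- the block-loop ∕ plaquette proportionality `α = cα·a` and the `wM` square-window constant at `a := 1`, `α := cα`
  obtain ⟨cα, hcα⟩ : ∃ t : ℝ, t = 2 * (8 * (((3 : ℕ) : ℝ) + 1) * (((3 : ℕ) : ℝ) + 4) * (L : ℝ) ^ 2) := ⟨_, rfl⟩
  obtain ⟨CΘ, hCΘdef⟩ : ∃ w : ℝ, w = (2 * (3 * ((Real.sqrt L)⁻¹ * (((3 : ℕ) : ℝ) * ((L : ℝ) ^ 2 / 4)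
                * (2 * ((L : ℝ) ^ (3 : ℕ))⁻¹ * (8 * ((((3 : ℕ) : ℝ) + 1) * (L : ℝ)) ^ 2 * 1 + 8 * cα) ^ 2 * ((3 : ℕ) : ℝ)))
              + (L : ℝ)⁻¹ * (2 * ((3 : ℕ) : ℝ) * (1 - (Real.sqrt L)⁻¹)⁻¹ * ((L : ℝ) ^ 2 / 4) * 2
                  * (((L : ℝ) ^ (3 : ℕ))⁻¹ * ((12 * ((2 : ℕ) : ℝ) * (((L * L + L - 1 : ℕ) : ℝ) + 1) ^ 2 * ((3 : ℕ) : ℝ) ^ 3 * ((L * L + L - 1 : ℕ) : ℝ) ^ 2 * 1 ^ 2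
                      + 3 * (2 * ((3 : ℕ) : ℝ) * L * (4 * cα) + 2 * ((3 * ((3 : ℕ) : ℝ) + 1) * (L * L + L - 1 : ℕ) : ℝ) ^ 2 * 1) ^ 2)
                        * (((3 : ℕ) : ℝ) * (((3 : ℕ) : ℝ) * ((2 : ℕ) : ℝ) ^ (3 : ℕ))))))
              + (Real.sqrt L)⁻¹ * (2 * (1 - (Real.sqrt L)⁻¹)⁻¹ * 2
                  * ((8 * ((3 : ℕ) : ℝ) ^ 6 * ((L : ℝ) - 1) ^ 6 + 2 * ((2 : ℕ) : ℝ) * ((3 : ℕ) : ℝ) ^ 5 * ((L : ℝ) - 1) ^ 4 * (L : ℝ) ^ 2) * 1 ^ 2 * ((3 : ℕ) : ℝ)))))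
          + 4 * (3 * ((L : ℝ)⁻¹ * (2 * ((3 : ℕ) : ℝ) * (1 - (Real.sqrt L)⁻¹)⁻¹ * ((L : ℝ) ^ 2 / 4) * 2 * (3 * ((L : ℝ) ^ 2)⁻¹ * ((L : ℝ) ^ (3 : ℕ))⁻¹ * ((3 : ℕ) : ℝ)))))
              * ((210 * ((2 * ((3 : ℕ) : ℝ) + 2) * L)) ^ 2 * cα ^ 2 * (2 * ((3 : ℕ) : ℝ)))) := ⟨_, rfl⟩
  have hCΘ : 0 ≤ CΘ := by
    rw [hCΘdef]
    have h1 : 0 ≤ ((L : ℝ) - 1) ^ 6 := by positivity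
    have h2 : 0 ≤ ((L : ℝ) - 1) ^ 4 := by positivity
    positivity
  -- the `θ′`, `θ_g` proportionality letters at unit cap (`aC := 1`) — both L-only and ≥ 0
  obtain ⟨Cθ, hCθ⟩ : ∃ t : ℝ, t = 210 * ((2 * ((3 : ℕ) : ℝ) + 2) * (L : ℝ)) * (2 * (8 * (((3 : ℕ) : ℝ) + 1) * (((3 : ℕ) : ℝ) + 4) * (L : ℝ) ^ 2 * 1)) * Real.sqrt (2 * ((3 : ℕ) : ℝ)) :=
    ⟨_, rfl⟩
  obtain ⟨Cg, hCg⟩ : ∃ t : ℝ, t = (24 * (2 * (8 * (((3 : ℕ) : ℝ) + 1) * (((3 : ℕ) : ℝ) + 4) * (L : ℝ) ^ 2 * 1)) + 8 * ((((3 : ℕ) : ℝ) + 2) * (L : ℝ)) ^ 2 * 1)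
        * Real.sqrt (((3 : ℕ) : ℝ) * ((L : ℝ) ^ 2 * ((L : ℝ) ^ (3 : ℕ))⁻¹))
      + 210 * ((2 * ((3 : ℕ) : ℝ) + 2) * (L : ℝ)) * (2 * (8 * (((3 : ℕ) : ℝ) + 1) * (((3 : ℕ) : ℝ) + 4) * (L : ℝ) ^ 2 * 1)) * Real.sqrt (8 * ((3 : ℕ) : ℝ) ^ 2) := ⟨_, rfl⟩
  have hCθ0 : 0 ≤ Cθ := by rw [hCθ]; positivity
  have hCg0 : 0 ≤ Cg := by rw [hCg]; positivity
  -- the radius: `eR := (4·10⁷·L³)⁻¹` (so `10⁷L³e ≤ 1` and the unscaled cap `4e ≤ 10⁻⁷L⁻³ ≤ 1`)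
  obtain ⟨eR, heR⟩ : ∃ t : ℝ, t = (4 * (10 ^ 7 * (L : ℝ) ^ 3))⁻¹ := ⟨_, rfl⟩
  have heR0 : 0 < eR := by rw [heR]; positivity
  -- the exponential at the cap and the kernel letters
  obtain ⟨r, hr⟩ : ∃ t : ℝ, t = (Real.sqrt (L : ℝ))⁻¹ / (1 - (Real.sqrt (L : ℝ))⁻¹) := ⟨_, rfl⟩
  have hρ2 : ((Real.sqrt (L : ℝ))⁻¹) ^ 2 < 1 := pow_lt_one₀ hρ0.le hρ1 (by norm_num)
  have hρ4 : ((Real.sqrt (L : ℝ))⁻¹) ^ 4 < 1 := pow_lt_one₀ hρ0.le hρ1 (by norm_num)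
  have hK30 : 0 ≤ (((Real.sqrt (L : ℝ))⁻¹) ^ 3 / (1 - ((Real.sqrt (L : ℝ))⁻¹) ^ 2)) := div_nonneg (by positivity) (by linarith)
  have hr0 : 0 ≤ r := by rw [hr]; exact div_nonneg hρ0.le (by linarith)
  obtain ⟨ER, hER⟩ : ∃ t : ℝ, t = Real.exp ((Cθ * (4 * eR)) * (((Real.sqrt (L : ℝ))⁻¹) ^ 3 / (1 - ((Real.sqrt (L : ℝ))⁻¹) ^ 4))) := ⟨_, rfl⟩
  have hER0 : 0 ≤ ER := by rw [hER]; exact (Real.exp_pos _).le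
  refine ⟨2 * ER ^ 2, 16 * wG * r, (4 * (4 * Cg) ^ 2 * (((Real.sqrt (L : ℝ))⁻¹) ^ 3 / (1 - ((Real.sqrt (L : ℝ))⁻¹) ^ 2)) ^ 2 + 64 * 3 * wG * r * (4 * Cg) ^ 2 * (((Real.sqrt (L : ℝ))⁻¹) ^ 3 / (1 - ((Real.sqrt (L : ℝ))⁻¹) ^ 2)) ^ 2 + 512 * 3 * CΘ * r) * ER ^ 2 + (16 * wG * r * (4 * Cg) ^ 2 * (((Real.sqrt (L : ℝ))⁻¹) ^ 3 / (1 - ((Real.sqrt (L : ℝ))⁻¹) ^ 2)) ^ 2 + 128 * CΘ * r) * ER ^ 2,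
    4 + 64 * 3 * wG * r, eR, by positivity, by positivity, by positivity, by positivity, heR0, ?_⟩
  intro F hF n K hnK ee W he heeR hreg A l hl
  letI : CStarAlgebra (Matrix (Fin 2) (Fin 2) ℂ) := B10Eq29TubeLine.cstarAlgebraMatrix 2
  have hFL : (F.L : ℝ) = (L : ℝ) := by exact_mod_cast hF
  have hPL : (F.P K).L = L := hF
  have hPLr : ((F.P K).L : ℝ) = (L : ℝ) := by exact_mod_cast hPL
  have hd : (F.P K).d = 3 := T3Family.P_d F K
  have hten7 : 10 ^ 7 * (F.L : ℝ) ^ 3 * ee ≤ 1 := by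
    rw [hFL]
    have hpos : (0 : ℝ) < 10 ^ 7 * (L : ℝ) ^ 3 := by positivity
    have : ee ≤ (10 ^ 7 * (L : ℝ) ^ 3)⁻¹ := heeR.trans (by rw [heR]; exact inv_anti₀ hpos (by linarith))
    rw [inv_eq_one_div, le_div_iff₀ hpos] at this; linarith
  have hKn : K - n ≤ F.m + K := by omega
  have hlK : l ≤ K - n := hl.le
  have hlm : l ≤ F.m + K := by omega
  have hL1 : 1 ≤ (F.P K).L := by rw [hPL]; omega
  have hL2F : 2 ≤ (F.P K).L := by rw [hPL]; exact hL2
  -- ===== the tower: `W♯`, the linTower family, the datum `A♯` =====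
  obtain ⟨Q, hQ0, hQs⟩ := exists_linTower_family (𝔸 := Matrix (Fin 2) (Fin 2) ℂ) (F.P K).L (pull (bgUnits F K W) (basePt F n K))
  -- the level-`l` cell as top: `N_l·Lˡ = N₀`
  have hNtop : (F.P K).sitesPerDir l * (F.P K).L ^ l = (F.P K).sitesPerDir 0 := sitesPerDir_T3_mul_pow F K hlm
  have hNpos : 0 < (F.P K).sitesPerDir l := by rw [sitesPerDir_T3]; have := F.hL.2; positivity
  have hU₀p : IsPeriodic ((F.P K).sitesPerDir l * (F.P K).L ^ l) (pull (bgUnits F K W) (basePt F n K)) := by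
    rw [hNtop]; exact isPeriodic_pull _ _
  have hYp : IsPeriodic ((F.P K).sitesPerDir l * (F.P K).L ^ l) (pull (G := Matrix (Fin 2) (Fin 2) ℂ) A (basePt F n K)) := by
    rw [hNtop]; exact isPeriodic_pull _ _
  -- ===== the windows in letters =====
  obtain ⟨af, haf⟩ : ∃ f : ℕ → ℝ, f = fun j => 2 * (2 * ee * ((((F.P K).L : ℝ)) ^ j * ((((F.P K).L : ℝ)) ^ (K - n))⁻¹) ^ 2) := ⟨_, rfl⟩
  obtain ⟨αf, hαf⟩ : ∃ f : ℕ → ℝ, f = fun j => 2 * (8 * (((F.P K).d : ℝ) + 1) * (((F.P K).d : ℝ) + 4) * ((F.P K).L : ℝ) ^ 2 * af j) := ⟨_, rfl⟩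
  have haf' : ∀ j, af j = 2 * (2 * ee * ((((F.P K).L : ℝ)) ^ j * ((((F.P K).L : ℝ)) ^ (K - n))⁻¹) ^ 2) := fun j => by rw [haf]
  have hαf' : ∀ j, αf j = 2 * (8 * (((F.P K).d : ℝ) + 1) * (((F.P K).d : ℝ) + 4) * ((F.P K).L : ℝ) ^ 2 * af j) := fun j => by rw [hαf]
  have ha0 : ∀ j, 0 ≤ af j := fun j => by rw [haf']; positivity
  have hα0 : ∀ j, 0 ≤ αf j := fun j => by rw [hαf']; have := ha0 j; positivity
  have hVu : ∀ j ≤ l, ∀ (x : LSite (F.P K).d) (μ : Fin (F.P K).d),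
      avgIter (F.P K).L (pull (bgUnits F K W) (basePt F n K)) j x μ ∈ unitaryUnits (Matrix (Fin 2) (Fin 2) ℂ) :=
    fun j hj x μ => avgIter_pull_mem_unitaryUnits_of_regPr F he hten7 W hreg (hj.trans hlK) x μ
  have hα24 : ∀ j < l, αf j ≤ 1 / 24 := fun j hj => by
    rw [hαf', haf']; exact (alpha_level_le_window F he hten7 W hreg (hj.le.trans hlK)).trans (by norm_num)
  have hα : ∀ j < l, ∀ (z : LSite (F.P K).d) (κ : Fin (F.P K).d) (r' : Fin (F.P K).d → Fin (F.P K).L),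
      ‖((Wcx (F.P K).L (avgIter (F.P K).L (pull (bgUnits F K W) (basePt F n K)) j) (((F.P K).L : ℤ) • z) κ (boxVec (F.P K).L r')
        : (Matrix (Fin 2) (Fin 2) ℂ)ˣ) : Matrix (Fin 2) (Fin 2) ℂ) - 1‖ ≤ αf j := fun j hj z κ r' => by
    rw [hαf', haf']; exact norm_Wcx_avgIter_pull_sub_one_le_level_of_regPr F he hten7 W hreg (hj.le.trans hlK) _ κ r'
  have hplaq : ∀ j < l, ∀ (x : LSite (F.P K).d) (κ' μ' : Fin (F.P K).d), κ' ≠ μ' →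
      ‖((hol (avgIter (F.P K).L (pull (bgUnits F K W) (basePt F n K)) j) x (B7Prop1Explicit.plaqWord κ' μ') : (Matrix (Fin 2) (Fin 2) ℂ)ˣ)
        : Matrix (Fin 2) (Fin 2) ℂ) - 1‖ ≤ af j := fun j hj x κ' μ' _ => by
    rw [haf']; exact norm_hol_plaqWord_avgIter_pull_sub_one_le_of_regPr F he hten7 W hreg (hj.le.trans hlK) x κ' μ'
  have hbs : ∀ j, j < l → ∀ (y : LSite (F.P K).d) (ν : Fin (F.P K).d),
      ‖((avgIter (F.P K).L (pull (bgUnits F K W) (basePt F n K)) (j + 1) y ν : (Matrix (Fin 2) (Fin 2) ℂ)ˣ) : Matrix (Fin 2) (Fin 2) ℂ)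
        - ((hol (avgIter (F.P K).L (pull (bgUnits F K W) (basePt F n K)) j) (((F.P K).L : ℤ) • y) (seg ν ((F.P K).L : ℤ)) :
            (Matrix (Fin 2) (Fin 2) ℂ)ˣ) : Matrix (Fin 2) (Fin 2) ℂ)‖ ≤ 4 * αf j := fun j hj y ν => by
    rw [hαf', haf']; exact norm_avgIter_succ_pull_sub_hol_seg_le_of_regPr F he hten7 W hreg (hj.le.trans hlK) y ν
  -- ===== the reduced family and its gauge function (✓F-8b-1, zero content) =====
  obtain ⟨Glin, -, hG0, -, hGlin, -⟩ := exists_sourced_reduced_family (F.P K).L (pull (bgUnits F K W) (basePt F n K))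
    (pull (G := Matrix (Fin 2) (Fin 2) ℂ) A (basePt F n K))
    (fun j X' y => FhatCov (F.P K).L (avgIter (F.P K).L (pull (bgUnits F K W) (basePt F n K)) j) X' (((F.P K).L : ℤ) • y)) (fun _ _ _ => 0)
  obtain ⟨Λ, hΛ0, hΛs⟩ := exists_gauge_family (𝔸 := Matrix (Fin 2) (Fin 2) ℂ) (F.P K).L
    (fun j X' y => FhatCov (F.P K).L (avgIter (F.P K).L (pull (bgUnits F K W) (basePt F n K)) j) X' (((F.P K).L : ℤ) • y)) Glin
  -- ===== the four cell letters (opaque), tower height `k := l` =====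
  obtain ⟨mf, hmf⟩ : ∃ f : ℕ → ℝ, f = fun j => Real.sqrt (∑ t : Fin (F.P K).d → Fin ((F.P K).sitesPerDir l * (F.P K).L ^ (l - j)),
      ∑ μ' : Fin (F.P K).d, ‖Glin j (boxVec ((F.P K).sitesPerDir l * (F.P K).L ^ (l - j)) t) μ'‖ ^ 2) := ⟨_, rfl⟩
  obtain ⟨yf, hyf⟩ : ∃ f : ℕ → ℝ, f = fun j => Real.sqrt (∑ t : Fin (F.P K).d → Fin ((F.P K).sitesPerDir l * (F.P K).L ^ (l - j)),
      ∑ μ' : Fin (F.P K).d, ‖Q j (pull (G := Matrix (Fin 2) (Fin 2) ℂ) A (basePt F n K)) (boxVec ((F.P K).sitesPerDir l * (F.P K).L ^ (l - j)) t) μ'‖ ^ 2) :=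
    ⟨_, rfl⟩
  obtain ⟨gf, hgf⟩ : ∃ f : ℕ → ℝ, f = fun j => Real.sqrt (∑ t : Fin (F.P K).d → Fin ((F.P K).sitesPerDir l * (F.P K).L ^ (l - j)),
      ∑ κ : Fin (F.P K).d, ∑ ν : Fin (F.P K).d,
        ‖conjR (avgIter (F.P K).L (pull (bgUnits F K W) (basePt F n K)) j (boxVec ((F.P K).sitesPerDir l * (F.P K).L ^ (l - j)) t) ν)
            (Glin j (boxVec ((F.P K).sitesPerDir l * (F.P K).L ^ (l - j)) t + e ν) κ)
          - Glin j (boxVec ((F.P K).sitesPerDir l * (F.P K).L ^ (l - j)) t) κ‖ ^ 2) := ⟨_, rfl⟩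
  obtain ⟨lamf, hlamf⟩ : ∃ f : ℕ → ℝ, f = fun j => Real.sqrt (∑ t : Fin (F.P K).d → Fin ((F.P K).sitesPerDir l * (F.P K).L ^ (l - j)),
      ∑ κ : Fin (F.P K).d, ‖Λ j (boxVec ((F.P K).sitesPerDir l * (F.P K).L ^ (l - j)) t)
        - conjR (avgIter (F.P K).L (pull (bgUnits F K W) (basePt F n K)) j (boxVec ((F.P K).sitesPerDir l * (F.P K).L ^ (l - j)) t) κ)
            (Λ j (boxVec ((F.P K).sitesPerDir l * (F.P K).L ^ (l - j)) t + e κ))‖ ^ 2) := ⟨_, rfl⟩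
  have hm00 : 0 ≤ mf 0 := by rw [hmf]; exact Real.sqrt_nonneg _
  have hg00 : 0 ≤ gf 0 := by rw [hgf]; exact Real.sqrt_nonneg _
  -- ===== the `ρ` letters (d = 3) =====
  have hρm : Real.sqrt (((F.P K).L : ℝ) ^ 2 * (((F.P K).L : ℝ) ^ (F.P K).d)⁻¹) = (Real.sqrt (L : ℝ))⁻¹ := by
    rw [hd, hPLr]; exact (rho_letters_T3 hL0r).1
  have hρg : Real.sqrt (((F.P K).L : ℝ) ^ 4 * (((F.P K).L : ℝ) ^ (F.P K).d)⁻¹) = ((Real.sqrt (L : ℝ))⁻¹)⁻¹ := by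
    rw [hd, hPLr]; exact (rho_letters_T3 hL0r).2
  have hρs : Real.sqrt (((F.P K).L : ℝ)) = ((Real.sqrt (L : ℝ))⁻¹)⁻¹ := by rw [hPLr, inv_inv]
  -- ===== the SCALED cap `aC := 4e·ρ^{4(K−n−l)}` and the window rows read at tower height `l` =====
  obtain ⟨aC, haC⟩ : ∃ t : ℝ, t = 2 * (2 * ee) * ((Real.sqrt (L : ℝ))⁻¹) ^ (4 * (K - n - l)) := ⟨_, rfl⟩
  have haC0 : 0 ≤ aC := by rw [haC]; positivity
  have haCle : aC ≤ 4 * eR := by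
    rw [haC]
    have : ((Real.sqrt (L : ℝ))⁻¹) ^ (4 * (K - n - l)) ≤ 1 := pow_le_one₀ hρ0.le hρ1.le
    rw [heR] at heeR
    nlinarith [he, heeR, this]
  have hafC : ∀ j < l, af j ≤ aC * ((Real.sqrt (L : ℝ))⁻¹) ^ (4 * (l - j)) := by
    intro j hj
    rw [haf', hPLr, level_ratio_sq_eq_rho_pow hL0r (hj.le.trans hlK), haC, mul_assoc (2 * (2 * ee)), ← pow_add,
      show 4 * (K - n - l) + 4 * (l - j) = 4 * (K - n - j) by omega]
    exact le_of_eq (by ring)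
  have hκgeo : ∀ j < l, 210 * ((2 * (F.P K).d + 2) * ((F.P K).L : ℝ)) * αf j * Real.sqrt (2 * (F.P K).d)
      ≤ (Cθ * aC) * ((Real.sqrt (L : ℝ))⁻¹) ^ (4 * (l - j)) := by
    intro j hj
    have h := kappa_geo_of_windows (d := (F.P K).d) (ρ := (Real.sqrt (L : ℝ))⁻¹) (aC := aC) (k := l) (a := af) (α := αf)
      (Nat.cast_nonneg _) hαf' hafC j hj
    rw [hCθ]
    rw [hd, hPLr] at h ⊢
    refine h.trans (le_of_eq ?_); ring
  have hKgeo : ∀ j < l, (24 * αf j + 8 * ((((F.P K).d : ℝ) + 2) * ((F.P K).L : ℝ)) ^ 2 * af j)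
        * Real.sqrt ((F.P K).d * (((F.P K).L : ℝ) ^ 2 * (((F.P K).L : ℝ) ^ (F.P K).d)⁻¹))
      + 210 * ((2 * (F.P K).d + 2) * ((F.P K).L : ℝ)) * αf j * Real.sqrt (8 * ((F.P K).d : ℝ) ^ 2)
      ≤ (Cg * aC) * ((Real.sqrt (L : ℝ))⁻¹) ^ (4 * (l - j)) := by
    intro j hj
    have h := K_geo_of_windows (d := (F.P K).d) (ρ := (Real.sqrt (L : ℝ))⁻¹) (aC := aC) (k := l) (a := af) (α := αf)
      (Nat.cast_nonneg _) hαf' hafC j hj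
    rw [hCg]
    rw [hd, hPLr] at h ⊢
    refine h.trans (le_of_eq ?_); ring
  -- ===== the weights: `wM` := ★routeR-w4's choice, its square window; `wG` as chosen =====
  obtain ⟨wM, hwMdef⟩ : ∃ f : ℕ → ℝ, f = fun i => 2 * (3 * ((Real.sqrt ((F.P K).L : ℝ))⁻¹ * (((F.P K).d : ℝ) * (((F.P K).L : ℝ) ^ 2 / 4)
    * (2 * (((F.P K).L : ℝ) ^ (F.P K).d)⁻¹ * (8 * ((((F.P K).d : ℝ) + 1) * ((F.P K).L : ℝ)) ^ 2 * af i + 8 * αf i) ^ 2 * ((F.P K).d : ℝ)))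
    + ((F.P K).L : ℝ)⁻¹ * (2 * ((F.P K).d : ℝ) * (1 - (Real.sqrt ((F.P K).L : ℝ))⁻¹)⁻¹ * (((F.P K).L : ℝ) ^ 2 / 4) * 2
    * ((((F.P K).L : ℝ) ^ (F.P K).d)⁻¹ * ((12 * ((2 : ℕ) : ℝ) * (((L * L + L - 1 : ℕ) : ℝ) + 1) ^ 2 * ((F.P K).d : ℝ) ^ 3 * ((L * L + L - 1 : ℕ) : ℝ) ^ 2 * af i ^ 2
    + 3 * (2 * ((F.P K).d : ℝ) * ((F.P K).L : ℝ) * (4 * αf i) + 2 * ((3 * ((F.P K).d : ℝ) + 1) * (L * L + L - 1 : ℕ) : ℝ) ^ 2 * af i) ^ 2) * (((F.P K).d : ℝ) * (((F.P K).d : ℝ) * ((2 : ℕ) : ℝ) ^ (F.P K).d)))))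
    + (Real.sqrt ((F.P K).L : ℝ))⁻¹ * (2 * (1 - (Real.sqrt ((F.P K).L : ℝ))⁻¹)⁻¹ * 2
    * ((8 * ((F.P K).d : ℝ) ^ 6 * (((F.P K).L : ℝ) - 1) ^ 6 + 2 * ((2 : ℕ) : ℝ) * ((F.P K).d : ℝ) ^ 5 * (((F.P K).L : ℝ) - 1) ^ 4 * ((F.P K).L : ℝ) ^ 2) * af i ^ 2 * ((F.P K).d : ℝ)))))
    + 4 * (3 * (((F.P K).L : ℝ)⁻¹ * (2 * ((F.P K).d : ℝ) * (1 - (Real.sqrt ((F.P K).L : ℝ))⁻¹)⁻¹ * (((F.P K).L : ℝ) ^ 2 / 4) * 2 * (3 * (((F.P K).L : ℝ) ^ 2)⁻¹ * (((F.P K).L : ℝ) ^ (F.P K).d)⁻¹ * ((F.P K).d : ℝ)))))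
    * ((210 * ((2 * ((F.P K).d : ℝ) + 2) * ((F.P K).L : ℝ))) ^ 2 * αf i ^ 2 * (2 * ((F.P K).d : ℝ))) := ⟨_, rfl⟩
  have hwM0 : ∀ j, 0 ≤ wM j := fun j => by rw [hwMdef]; exact wM_choice_nonneg (F.P K).L (F.P K).d 2 (L * L + L - 1) 2 hL2F af αf j
  have hαa : ∀ j, αf j ≤ cα * af j := fun j => le_of_eq (by rw [hαf', hcα, hd, hPLr]; ring)
  have hwMgeo : ∀ j < l, wM j ≤ (CΘ * aC ^ 2) * ((Real.sqrt (L : ℝ))⁻¹) ^ (4 * (l - j)) := by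
    intro j hj
    have h := wM_choice_geo (F.P K).L (F.P K).d 2 (L * L + L - 1) 2 hL2F hρ0.le hρ1.le af αf ha0 hα0 hαa hafC j hj
    rw [hwMdef]; dsimp only
    rw [hCΘdef]
    rw [hd, hPLr] at h ⊢
    exact h
  -- ===== the two `m₀`∕`g₀`-dependent constants (✓1a, top-anchored at `k := l`) =====
  have hE0 : 0 ≤ Real.exp ((Cθ * aC) * (((Real.sqrt (L : ℝ))⁻¹) ^ 3 / (1 - ((Real.sqrt (L : ℝ))⁻¹) ^ 4))) := (Real.exp_pos _).le
  have hEle : Real.exp ((Cθ * aC) * (((Real.sqrt (L : ℝ))⁻¹) ^ 3 / (1 - ((Real.sqrt (L : ℝ))⁻¹) ^ 4))) ≤ ER := by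
    rw [hER]
    apply Real.exp_le_exp.mpr
    have hk : 0 ≤ ((Real.sqrt (L : ℝ))⁻¹) ^ 3 / (1 - ((Real.sqrt (L : ℝ))⁻¹) ^ 4) := div_nonneg (by positivity) (by linarith)
    exact mul_le_mul_of_nonneg_right (mul_le_mul_of_nonneg_left haCle hCθ0) hk
  obtain ⟨cA, hcAdef⟩ : ∃ t : ℝ, t = Real.sqrt (2 * (CΘ * aC ^ 2) * r) * (Real.exp ((Cθ * aC) * (((Real.sqrt (L : ℝ))⁻¹) ^ 3 / (1 - ((Real.sqrt (L : ℝ))⁻¹) ^ 4))) * mf 0) := ⟨_, rfl⟩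
  obtain ⟨cB0, hcB0def⟩ : ∃ t : ℝ, t = Real.sqrt (2 * wG * r)
      * (gf 0 + (Cg * aC) * Real.exp ((Cθ * aC) * (((Real.sqrt (L : ℝ))⁻¹) ^ 3 / (1 - ((Real.sqrt (L : ℝ))⁻¹) ^ 4))) * mf 0 * ((Real.sqrt (L : ℝ))⁻¹) ^ (2 * l) * (((Real.sqrt (L : ℝ))⁻¹) ^ 3 / (1 - ((Real.sqrt (L : ℝ))⁻¹) ^ 2))) := ⟨_, rfl⟩
  have hcA0 : 0 ≤ cA := by rw [hcAdef]; exact mul_nonneg (Real.sqrt_nonneg _) (mul_nonneg hE0 hm00)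
  have hθg0 : 0 ≤ Cg * aC := mul_nonneg hCg0 haC0
  have hcB00 : 0 ≤ cB0 := by
    rw [hcB0def]
    exact mul_nonneg (Real.sqrt_nonneg _) (add_nonneg hg00 (mul_nonneg (mul_nonneg (mul_nonneg (mul_nonneg hθg0 hE0) hm00) (pow_nonneg hρ0.le _)) hK30))
  have hcAsq' : cA ^ 2 = 2 * (CΘ * aC ^ 2) * r * (Real.exp ((Cθ * aC) * (((Real.sqrt (L : ℝ))⁻¹) ^ 3 / (1 - ((Real.sqrt (L : ℝ))⁻¹) ^ 4))) * mf 0) ^ 2 := by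
    rw [hcAdef, mul_pow, Real.sq_sqrt (by positivity)]
  have hcAsq : 2 * ((CΘ * aC ^ 2) * (Real.exp ((Cθ * aC) * (((Real.sqrt (L : ℝ))⁻¹) ^ 3 / (1 - ((Real.sqrt (L : ℝ))⁻¹) ^ 4))) * mf 0) ^ 2) * ((Real.sqrt (L : ℝ))⁻¹ / (1 - (Real.sqrt (L : ℝ))⁻¹)) ≤ cA ^ 2 := by
    rw [hcAsq', ← hr]; exact le_of_eq (by ring)
  have hcB0sq' : cB0 ^ 2 = 2 * wG * r * (gf 0 + (Cg * aC) * Real.exp ((Cθ * aC) * (((Real.sqrt (L : ℝ))⁻¹) ^ 3 / (1 - ((Real.sqrt (L : ℝ))⁻¹) ^ 4))) * mf 0 * ((Real.sqrt (L : ℝ))⁻¹) ^ (2 * l) * (((Real.sqrt (L : ℝ))⁻¹) ^ 3 / (1 - ((Real.sqrt (L : ℝ))⁻¹) ^ 2))) ^ 2 := by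
    rw [hcB0def, mul_pow, Real.sq_sqrt (by positivity)]
  have hcB0sq : 2 * wG * (gf 0 + (Cg * aC) * Real.exp ((Cθ * aC) * (((Real.sqrt (L : ℝ))⁻¹) ^ 3 / (1 - ((Real.sqrt (L : ℝ))⁻¹) ^ 4))) * mf 0 * ((Real.sqrt (L : ℝ))⁻¹) ^ (2 * l)
      * (((Real.sqrt (L : ℝ))⁻¹) ^ 3 / (1 - ((Real.sqrt (L : ℝ))⁻¹) ^ 2))) ^ 2 * ((Real.sqrt (L : ℝ))⁻¹ / (1 - (Real.sqrt (L : ℝ))⁻¹)) ≤ cB0 ^ 2 := by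
    rw [hcB0sq', ← hr]; exact le_of_eq (by ring)
  -- ===== the cube letters and the two dominations =====
  obtain ⟨hnC, hnA⟩ := numerals_nC_AC (show 1 ≤ L by omega)
  have hcΓ0 : 0 ≤ 3 * ((Real.sqrt ((F.P K).L : ℝ))⁻¹ * (((F.P K).d : ℝ) * (((F.P K).L : ℝ) ^ 2 / 4) * (2 * (((F.P K).L : ℝ) ^ (F.P K).d)⁻¹ * ((F.P K).L : ℝ) * ((F.P K).L : ℝ)))
      + ((F.P K).L : ℝ)⁻¹ * (2 * ((F.P K).d : ℝ) * (1 - (Real.sqrt ((F.P K).L : ℝ))⁻¹)⁻¹ * (((F.P K).L : ℝ) ^ 2 / 4) * 2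
      * ((((F.P K).L : ℝ) ^ (F.P K).d)⁻¹ * (3 * ((2 : ℕ) : ℝ) * (((L * L + L - 1 : ℕ) : ℝ) + 1) ^ 2 * (((F.P K).d : ℝ) * (((F.P K).d : ℝ) * ((2 : ℕ) : ℝ) ^ (F.P K).d)))))
      + (Real.sqrt ((F.P K).L : ℝ))⁻¹ * (2 * (1 - (Real.sqrt ((F.P K).L : ℝ))⁻¹)⁻¹ * 2 * (((2 : ℕ) : ℝ) / 2 * ((F.P K).d : ℝ) ^ 2 * (((F.P K).L : ℝ) - 1) ^ 2 * ((F.P K).L : ℝ) ^ 2 * ((F.P K).d : ℝ)))) := by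
    rw [hPLr]
    have h1 : 0 ≤ ((L : ℝ) - 1) ^ 2 := sq_nonneg _
    positivity
  have hdomG : 3 * ((Real.sqrt ((F.P K).L : ℝ))⁻¹ * (((F.P K).d : ℝ) * (((F.P K).L : ℝ) ^ 2 / 4) * (2 * (((F.P K).L : ℝ) ^ (F.P K).d)⁻¹ * ((F.P K).L : ℝ) * ((F.P K).L : ℝ)))
      + ((F.P K).L : ℝ)⁻¹ * (2 * ((F.P K).d : ℝ) * (1 - (Real.sqrt ((F.P K).L : ℝ))⁻¹)⁻¹ * (((F.P K).L : ℝ) ^ 2 / 4) * 2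
      * ((((F.P K).L : ℝ) ^ (F.P K).d)⁻¹ * (3 * ((2 : ℕ) : ℝ) * (((L * L + L - 1 : ℕ) : ℝ) + 1) ^ 2 * (((F.P K).d : ℝ) * (((F.P K).d : ℝ) * ((2 : ℕ) : ℝ) ^ (F.P K).d)))))
      + (Real.sqrt ((F.P K).L : ℝ))⁻¹ * (2 * (1 - (Real.sqrt ((F.P K).L : ℝ))⁻¹)⁻¹ * 2 * (((2 : ℕ) : ℝ) / 2 * ((F.P K).d : ℝ) ^ 2 * (((F.P K).L : ℝ) - 1) ^ 2 * ((F.P K).L : ℝ) ^ 2 * ((F.P K).d : ℝ)))) ≤ wG := by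
    have h2 := hcΓ0
    rw [hwGdef]; rw [hd, hPLr] at h2 ⊢
    linarith
  have hcΔX0 : ∀ i, 0 ≤ 3 * (((F.P K).L : ℝ)⁻¹ * (2 * ((F.P K).d : ℝ) * (1 - (Real.sqrt ((F.P K).L : ℝ))⁻¹)⁻¹ * (((F.P K).L : ℝ) ^ 2 / 4) * 2 * (3 * (((F.P K).L : ℝ) ^ 2)⁻¹ * (((F.P K).L : ℝ) ^ (F.P K).d)⁻¹ * ((F.P K).d : ℝ))))
      * ((210 * ((2 * (F.P K).d + 2) * (F.P K).L)) ^ 2 * αf i ^ 2 * (2 * (F.P K).d)) := by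
    intro i; rw [hPLr]; have := hα0 i; positivity
  have hdomM : ∀ i < l, 3 * ((Real.sqrt ((F.P K).L : ℝ))⁻¹ * (((F.P K).d : ℝ) * (((F.P K).L : ℝ) ^ 2 / 4)
      * (2 * (((F.P K).L : ℝ) ^ (F.P K).d)⁻¹ * (8 * ((((F.P K).d : ℝ) + 1) * ((F.P K).L : ℝ)) ^ 2 * af i + 8 * αf i) ^ 2 * ((F.P K).d : ℝ)))
      + ((F.P K).L : ℝ)⁻¹ * (2 * ((F.P K).d : ℝ) * (1 - (Real.sqrt ((F.P K).L : ℝ))⁻¹)⁻¹ * (((F.P K).L : ℝ) ^ 2 / 4) * 2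
      * ((((F.P K).L : ℝ) ^ (F.P K).d)⁻¹ * ((12 * ((2 : ℕ) : ℝ) * (((L * L + L - 1 : ℕ) : ℝ) + 1) ^ 2 * ((F.P K).d : ℝ) ^ 3 * ((L * L + L - 1 : ℕ) : ℝ) ^ 2 * af i ^ 2
      + 3 * (2 * (F.P K).d * (F.P K).L * (4 * αf i) + 2 * ((3 * (F.P K).d + 1) * (L * L + L - 1 : ℕ) : ℝ) ^ 2 * af i) ^ 2) * (((F.P K).d : ℝ) * (((F.P K).d : ℝ) * ((2 : ℕ) : ℝ) ^ (F.P K).d)))))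
      + (Real.sqrt ((F.P K).L : ℝ))⁻¹ * (2 * (1 - (Real.sqrt ((F.P K).L : ℝ))⁻¹)⁻¹ * 2
      * ((8 * ((F.P K).d : ℝ) ^ 6 * (((F.P K).L : ℝ) - 1) ^ 6 + 2 * ((2 : ℕ) : ℝ) * ((F.P K).d : ℝ) ^ 5 * (((F.P K).L : ℝ) - 1) ^ 4 * ((F.P K).L : ℝ) ^ 2) * af i ^ 2 * ((F.P K).d : ℝ))))
      + 3 * (((F.P K).L : ℝ)⁻¹ * (2 * ((F.P K).d : ℝ) * (1 - (Real.sqrt ((F.P K).L : ℝ))⁻¹)⁻¹ * (((F.P K).L : ℝ) ^ 2 / 4) * 2 * (3 * (((F.P K).L : ℝ) ^ 2)⁻¹ * (((F.P K).L : ℝ) ^ (F.P K).d)⁻¹ * ((F.P K).d : ℝ))))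
        * ((210 * ((2 * (F.P K).d + 2) * (F.P K).L)) ^ 2 * αf i ^ 2 * (2 * (F.P K).d)) ≤ wM i := by
    intro i _
    have hw := hwM0 i
    have hx := hcΔX0 i
    rw [hwMdef] at hw ⊢; dsimp only at hw ⊢
    linarith
  -- ===== ★ the sourceless gauge row (✓F-9d-b) =====
  have hrow₀ := gauge_row_sourceless (N := 2) (F.P K).L ((F.P K).sitesPerDir l) l hL2F hNpos (pull (bgUnits F K W) (basePt F n K)) hU₀p hVu αf af hα24 hα ha0 hplaq
    (fun j => 4 * αf j) (fun j => by have := hα0 j; positivity) hbs (L * L + L - 1) 2 (by rw [hPL]; exact hnC) (by rw [hPL]; exact hnA)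
    (pull (G := Matrix (Fin 2) (Fin 2) ℂ) A (basePt F n K)) hYp Glin Λ hG0 hΛ0
    (fun j z κ => by have h := hGlin j z κ; simp only [add_zero] at h; exact h) (fun j z => hΛs j z)
    mf gf lamf (fun j => by rw [hmf]) (fun j => by rw [hgf]) (fun j => by rw [hlamf]) hρs wM hdomG hdomM
  -- ===== ★ the sourceless cell rows (✓F-9d-a) at height `k := l` =====
  have hW : ∀ j < l, ∀ (z : LSite (F.P K).d) (κ : Fin (F.P K).d) (r' : Fin (F.P K).d → Fin (F.P K).L),
      ‖((Wcx (F.P K).L (avgIter (F.P K).L (pull (bgUnits F K W) (basePt F n K)) j) (((F.P K).L : ℤ) • z) κ (boxVec (F.P K).L r')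
        : (Matrix (Fin 2) (Fin 2) ℂ)ˣ) : Matrix (Fin 2) (Fin 2) ℂ) - 1‖ ≤ αf j := hα
  have hcell := sum_cell_linTower_rows (F.P K).L ((F.P K).sitesPerDir l) l hL1 hNpos (pull (bgUnits F K W) (basePt F n K)) hU₀p hVu αf af hα0 hα24 hW
    ha0 hplaq (pull (G := Matrix (Fin 2) (Fin 2) ℂ) A (basePt F n K)) hYp Q (hQ0 _) (fun j z κ => hQs j _ z κ) Glin Λ hG0 hΛ0
    (fun j z κ => by have h := hGlin j z κ; simp only [add_zero] at h; exact h) (fun j z => hΛs j z)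
    mf gf yf lamf (fun j => by rw [hmf]) (fun j => by rw [hyf]) (fun j => by rw [hgf]) (fun j => by rw [hlamf])
    hρ0 hρ1 hρm hρg (mul_nonneg hCθ0 haC0) hθg0 (mul_nonneg hCΘ (sq_nonneg _)) hwG hcA0 hcB00 wM hwM0 hwMgeo hκgeo hKgeo hrow₀ hcB0sq hcAsq l le_rfl
  obtain ⟨hMASS, hGRAD⟩ := hcell
  -- ===== the letters read on `T³` =====
  have hN0 : (F.P K).sitesPerDir 0 = (F.P K).sitesPerDir l * (F.P K).L ^ (l - 0) := by rw [Nat.sub_zero]; exact hNtop.symm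
  have hm0 : mf 0 ^ 2 = ∑ b : PBond (F.P K) 0, ‖A b‖ ^ 2 := by
    rw [hmf]; dsimp only
    rw [Real.sq_sqrt (Finset.sum_nonneg fun _ _ => Finset.sum_nonneg fun _ _ => sq_nonneg _), hG0]
    exact cell_mass_eq_SA F hN0 A
  have hg0 : gf 0 ^ 2 = ∑ b : PBond (F.P K) 0, ∑ ν : Fin (F.P K).d,
      ‖((W ⟨b.src, ν⟩ : Matrix.specialUnitaryGroup (Fin 2) ℂ) : Matrix (Fin 2) (Fin 2) ℂ) * A ⟨b.src.shift ν, b.dir⟩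
          * star ((W ⟨b.src, ν⟩ : Matrix.specialUnitaryGroup (Fin 2) ℂ) : Matrix (Fin 2) (Fin 2) ℂ) - A b‖ ^ 2 := by
    rw [hgf]; dsimp only
    rw [Real.sq_sqrt (Finset.sum_nonneg fun _ _ => Finset.sum_nonneg fun _ _ => Finset.sum_nonneg fun _ _ => sq_nonneg _), hG0]
    exact cell_covGrad_eq_GA F hN0 W A
  obtain ⟨hanch, hLL, hρ2l⟩ := anchor_arith_T3 hL0r hlK
  obtain ⟨hs1, hs2⟩ := rho_slots_T3 hL0r l
  have hNl : (F.P K).sitesPerDir l * (F.P K).L ^ (l - l) = (F.P K).sitesPerDir l := by rw [Nat.sub_self, pow_zero, mul_one]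
  refine ⟨?_, fun μ => ?_⟩
  · -- (hN′)
    rw [sum_site_normSq_linResponse_eq_cell F he hten7 W hreg Q hQ0 hQs A hlK hNl.symm, hFL]
    have := mass_three_slots (K₃ := (((Real.sqrt (L : ℝ))⁻¹) ^ 3 / (1 - ((Real.sqrt (L : ℝ))⁻¹) ^ 2))) (CΘ := CΘ) (Cg := 4 * Cg) (s := ((Real.sqrt (L : ℝ))⁻¹) ^ (4 * (K - n - l))) (e := ee)
      (W := (L : ℝ) ^ (3 * l) * (((L : ℝ) ^ (K - n)) ^ 4)⁻¹) hMASS hm0 hg0 hs1 hs2 hρ2l hcB0sq' hcAsq' (by rw [haC]; ring) (by rw [haC]; ring) hanch hE0 hEle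
      (Finset.sum_nonneg fun _ _ => sq_nonneg _) hwG hr0 (by positivity) (by positivity) hCΘ
    have hx : 0 ≤ (4 * (4 * Cg) ^ 2 * (((Real.sqrt (L : ℝ))⁻¹) ^ 3 / (1 - ((Real.sqrt (L : ℝ))⁻¹) ^ 2)) ^ 2 + 64 * 3 * wG * r * (4 * Cg) ^ 2 * (((Real.sqrt (L : ℝ))⁻¹) ^ 3 / (1 - ((Real.sqrt (L : ℝ))⁻¹) ^ 2)) ^ 2 + 512 * 3 * CΘ * r) * ER ^ 2
        * (ee ^ 2 * ((L : ℝ) ^ (3 * l) * (((L : ℝ) ^ (K - n)) ^ 4)⁻¹) * ∑ b : PBond (F.P K) 0, ‖A b‖ ^ 2) := by positivity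
    linarith [this, hx]
  · -- (hG), direction `μ`
    rw [sum_site_normSq_covGrad_linResponse_eq_cell F he hten7 W hreg Q hQ0 hQs A hlK hNl.symm μ, hFL]
    have hdir := sum_cell_covGrad_dir_le_of_sum _ _ hGRAD μ
    have hrev : ∑ t : Fin (F.P K).d → Fin ((F.P K).sitesPerDir l * (F.P K).L ^ (l - l)), ∑ κ : Fin (F.P K).d,
        ‖Q l (pull (G := Matrix (Fin 2) (Fin 2) ℂ) A (basePt F n K)) (boxVec ((F.P K).sitesPerDir l * (F.P K).L ^ (l - l)) t) κ
          - conjR (avgIter (F.P K).L (pull (bgUnits F K W) (basePt F n K)) l (boxVec ((F.P K).sitesPerDir l * (F.P K).L ^ (l - l)) t) μ)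
              (Q l (pull (G := Matrix (Fin 2) (Fin 2) ℂ) A (basePt F n K)) (boxVec ((F.P K).sitesPerDir l * (F.P K).L ^ (l - l)) t + e μ) κ)‖ ^ 2
        = ∑ t : Fin (F.P K).d → Fin ((F.P K).sitesPerDir l * (F.P K).L ^ (l - l)), ∑ κ : Fin (F.P K).d,
        ‖conjR (avgIter (F.P K).L (pull (bgUnits F K W) (basePt F n K)) l (boxVec ((F.P K).sitesPerDir l * (F.P K).L ^ (l - l)) t) μ)
              (Q l (pull (G := Matrix (Fin 2) (Fin 2) ℂ) A (basePt F n K)) (boxVec ((F.P K).sitesPerDir l * (F.P K).L ^ (l - l)) t + e μ) κ)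
          - Q l (pull (G := Matrix (Fin 2) (Fin 2) ℂ) A (basePt F n K)) (boxVec ((F.P K).sitesPerDir l * (F.P K).L ^ (l - l)) t) κ‖ ^ 2 :=
      Finset.sum_congr rfl fun t _ => Finset.sum_congr rfl fun κ _ => by rw [norm_sub_rev]
    rw [hrev]
    have hd3 : ((F.P K).d : ℝ) = 3 := by rw [hd]; norm_num
    rw [hd3] at hdir
    have := grad_two_slots (dd := 3) (K₃ := (((Real.sqrt (L : ℝ))⁻¹) ^ 3 / (1 - ((Real.sqrt (L : ℝ))⁻¹) ^ 2))) (CΘ := CΘ) (Cg := 4 * Cg) (s := ((Real.sqrt (L : ℝ))⁻¹) ^ (4 * (K - n - l))) (e := ee)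
      (W := (L : ℝ) ^ (3 * l) * (((L : ℝ) ^ (K - n)) ^ 4)⁻¹) hdir hm0 hg0 hs2 hρ2l hcB0sq' hcAsq' (by rw [haC]; ring) (by rw [haC]; ring) hanch hE0 hEle
      (Finset.sum_nonneg fun _ _ => sq_nonneg _) hwG hr0 (by positivity) hCΘ (by norm_num)
    have hx : 0 ≤ (16 * wG * r * (4 * Cg) ^ 2 * (((Real.sqrt (L : ℝ))⁻¹) ^ 3 / (1 - ((Real.sqrt (L : ℝ))⁻¹) ^ 2)) ^ 2 + 128 * CΘ * r) * ER ^ 2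
        * (ee ^ 2 * ((L : ℝ) ^ (3 * l) * (((L : ℝ) ^ (K - n)) ^ 4)⁻¹) * ∑ b : PBond (F.P K) 0, ‖A b‖ ^ 2) := by positivity
    linarith [this, hx]

end Summit.QuantumFields.YangMills.Theorems.Prop7RLegsLinTowerRowsOfRegPr

end
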